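import Mathlib
import HarnessLib
import Summits.HubbardSuperconductivity.HubbardSuperconductivity.Theorems.KLProgrammeKLRegimeWickScaleFlowRungs
import Summits.HubbardSuperconductivity.HubbardSuperconductivity.Theorems.KLProgrammeKLRegimeWickCarriersDefs
import Summits.HubbardSuperconductivity.HubbardSuperconductivity.Theorems.KLProgrammeKLRegimeEnginePairLadderTowerComposeV10

/-!
# Route `KLProgramme` — crux K3, ENGINE child gen 6 (stmt-HubbardSuperconductivity-20236 `KLRegimeEngineV16`), stub `stub_engine_step_values`,
# conjunct (E2-v10) at `1 ≤ n`: the END-TO-END composition on the continuous organisation — `pairLadderStepAtV10_of_scaleFlow`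

Cell gate-hubbard-kl, seat hubbard-kl-k3c1-p1 (g7), technique «composed-map remainder propagation».  This file composes the landed model-level
bridge (KLTC-INDEX-v3: `…WickScaleFlow{,C1,Slice,Lines,Rungs,X}`, `…EnginePairLadderTowerCompose{,Fwd,V10}`) into ONE theorem whose hypotheses
are exactly the taker's analytic list and whose conclusion is the slot clause `PairLadderStepAtV10 … n` of `…SplitEngineV10`, BY NAME:

* §1 **`klws_wickArrayStep_of_scaleFlow_grid`** — the Wick step (W-a)_n for p1's ball-truncated Wick pair arrays
  `X := klWickPairArray … (n−1) Qm`, `Y := klWickPairArray … n Qm`, from the within-slice flow on `[Λ_n, Λ_{n−1}]` with the EXPLICIT soft-pair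
  rungs `b t z = −(βL²)⁻¹ĝ_K(p)ĝ_K(p̄)(1 − w_{Λ(t)}(p))(1 − w_{Λ(t)}(p̄))` of `klws_flow_source_eq`: the calculus inputs `hb`, `hb'c` and the TAIL
  profile `ρ := ‖b 1 − b 0‖` (monotonicity, `…WickScaleFlowRungs`) and the rate bound (compactness) are DISCHARGED here; what remains is
  `Z^K ≠ 0` on the slice, an a priori entry bound `m_W` of the real-cutoff pair kernel along the slice, the step mass `Σ‖b 1 − b 0‖ ≤ Z_ρ` with
  `(3/2)m_W·Z_ρ ≤ 1/3`, the reality of the aggregated step weight `Σ_ν (b 1 − b 0)(k,ν) = w₁(k) ∈ ℝ`, and a majorant `IX ≥ ∫₀¹‖X_t‖` of the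
  non-ladder source `X_t := Γ̇_t + Γ_t·diag(ḃ_t)·Γ_t` (read it through `klws_flow_source_eq`).  Conclusion: `∃ N` two-sided inverse of
  `1 + diag w₁·X` with `‖Y(k,k′) − (X·N)(k,k′)‖ ≤ FT_ρ(IX)((k,ω₀),(k′,ω₀)) + [frequency-localisation four-term of K_{n−1}(Qm) against X]` on `klBall²`.
* §2 **`pairLadderStepAtV10_of_scaleFlow`** — §1 for every pair class + the forward straddle relations (S)_{n−1}, (S)_n, the intermediate
  majorants, the smallness conditions, the two mass clauses of the composite weight `w₁ + b − b′` and the closed-form V10 budget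
  (`pairLadderStepAtV10_of_wickTower_fwd`) ⟹ `PairLadderStepAtV10 L M G P Q β U μ K n`.

Exact calculus and algebra over the landed files; every size is a hypothesis; nothing about superconductivity is asserted.  0 kit.
-/

noncomputable section

namespace Summit.HubbardSuperconductivity.HubbardSuperconductivity.Theorems.KLRegimeWick

set_option linter.dupNamespace false -- summit = problem name (single-conjunct summit), D-0017

open Set Finset Matrix Literature.MathematicalPhysics.QuantumLattice GrassmannAlgebra
open Literature.Probability.LatticeModels
open Summit.HubbardSuperconductivity.HubbardSuperconductivity.Theorems.TwoPointAssembly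
open Summit.HubbardSuperconductivity.HubbardSuperconductivity.Theorems.KLProgrammeLegKernels
open Summit.HubbardSuperconductivity.HubbardSuperconductivity.Theorems.KLRegimeSplit
open scoped Topology

section Model

variable (L M : ℕ) [NeZero L] [NeZero M] (β U μ : ℝ) (K : TrigPolyC4v)

/-! ## §1 The Wick step (W-a)_n of the ball-truncated Wick pair arrays from the scale flow -/

/-- Off the ball the Wick pair array vanishes. -/
theorem klws_wickPairArray_eq_zero_off (n : ℕ) (Q : TorusSite 2 L) (x y : TorusSite 2 L)
    (hxy : ¬(x ∈ klBall L μ K ∧ y ∈ klBall L μ K)) : klWickPairArray L M β U μ K n Q x y = 0 := by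
  simp only [klWickPairArray, Matrix.of_apply, if_neg hxy]

/-- On the ball the Wick pair array is the Wick pair kernel at the lowest frequencies. -/
theorem klws_wickPairArray_eq_kernel_on (n : ℕ) (Q : TorusSite 2 L) {k k' : TorusSite 2 L} (hk : k ∈ klBall L μ K)
    (hk' : k' ∈ klBall L μ K) :
    klWickPairArray L M β U μ K n Q k k' = klWickPairKernel L M β U μ K n Q (k, omega0 M) (k', omega0 M) := by
  simp only [klWickPairArray, Matrix.of_apply, if_pos (And.intro hk hk')]
  rfl

/-- **The Wick step (W-a)_n of the model's ball-truncated Wick pair arrays from the within-slice flow** (grid slice `[Λ_n, Λ_{n−1}]`).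
Inputs: `Z^K ≠ 0` on the slice; `Γ, Γ̇` the real-cutoff pair kernel and its derivative along the affine path, the explicit soft-pair rungs
`b, ḃ` and the source `X_t := Γ̇_t + Γ_t·diag(ḃ_t)·Γ_t` (all given by equations — pass `rfl` five times); a real `w₁` with
`Σ_ν (b 1 − b 0)(k,ν) = w₁ k`; an a priori bound `‖Γ_t‖ ≤ m_W` along the slice; the step mass `Σ‖b 1 − b 0‖ ≤ Z_ρ` with `(3/2)m_W Z_ρ ≤ 1/3`;
a majorant `∫₀¹‖X_t(x,y)‖dt ≤ IX(x,y)`.  THEN, with `X := klWickPairArray … (n−1) Q`, `Y := klWickPairArray … n Q`, `ρ := ‖b 1 − b 0‖`,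
`K := klWickPairKernel … (n−1) Q`: `∃ N`, `(1 + diag w₁·X)·N = 1 = N·(1 + diag w₁·X)` and on `klBall²`
`‖Y(k,k′) − (X·N)(k,k′)‖ ≤ [IX + (3/2)(3/2 m_W)Σ_c IX(·,c)ρ_c + (3/2)m_W Σ_a ρ_a IX(a,·) + (9/4)m_W(3/2 m_W)Σ_aΣ_c ρ_a IX(a,c)ρ_c]((k,ω₀),(k′,ω₀))
 + (3/2)m_W Σ_c ‖K((k,ω₀),c) − X(k,c.1)‖ρ_c + (3/2)m_W Σ_a ρ_a‖K(a,(k′,ω₀)) − X(a.1,k′)‖ + (9/4)m_W² Σ_aΣ_c ρ_a‖K(a,c) − X(a.1,c.1)‖ρ_c`. -/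
theorem klws_wickArrayStep_of_scaleFlow_grid (n : ℕ)
    (hZ : ∀ Λ ∈ Icc (klScale klE0 n) (klScale klE0 (n - 1)), hubbardEffPartitionFnCT L M β U μ 0 K Λ ≠ 0) (Q : TorusSite 2 L)
    (Γ Γ' Xs : ℝ → Matrix (TorusSite 2 L × MatsubaraIdx M) (TorusSite 2 L × MatsubaraIdx M) ℂ)
    (b b' : ℝ → TorusSite 2 L × MatsubaraIdx M → ℂ)
    (hΓdef : Γ = fun t => Matrix.of fun x y => vertexFn L M β
      (gaussConv ℂ (hubbardCovBelowCT L M β μ 0 K (klScale klE0 (n - 1) + t * (klScale klE0 n - klScale klE0 (n - 1))))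
        (hubbardEffectiveActionCT L M β U μ 0 K (klScale klE0 (n - 1) + t * (klScale klE0 n - klScale klE0 (n - 1))))) 4
      ![(((y.2, y.1), 0), 0), (((y.2.rev, Q - y.1), 1), 0), (((x.2.rev, Q - x.1), 1), 1), (((x.2, x.1), 0), 1)])
    (hΓ'def : Γ' = fun t => Matrix.of fun x y => (klScale klE0 n - klScale klE0 (n - 1)) • -((2 : ℂ)⁻¹ * vertexFn L M β
      (gaussConv ℂ (hubbardCovBelowCT L M β μ 0 K (klScale klE0 (n - 1) + t * (klScale klE0 n - klScale klE0 (n - 1))))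
        (grassmannDerivPairing ℂ
          (Matrix.of fun X Y : HubbardFieldIdx L M =>
            deriv (fun Λ'' : ℝ => hubbardCovAboveCT L M β μ 0 K Λ'' X Y)
              (klScale klE0 (n - 1) + t * (klScale klE0 n - klScale klE0 (n - 1))))
          (hubbardEffectiveActionCT L M β U μ 0 K (klScale klE0 (n - 1) + t * (klScale klE0 n - klScale klE0 (n - 1))))
          (hubbardEffectiveActionCT L M β U μ 0 K (klScale klE0 (n - 1) + t * (klScale klE0 n - klScale klE0 (n - 1)))))) 4
      ![(((y.2, y.1), 0), 0), (((y.2.rev, Q - y.1), 1), 0), (((x.2.rev, Q - x.1), 1), 1), (((x.2, x.1), 0), 1)]))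
    (hbdef : b = fun t z => -((((β * (L : ℝ) ^ 2 : ℝ) : ℂ))⁻¹ * propCT L M β μ K (z.2, z.1) * propCT L M β μ K (z.2.rev, Q - z.1)) *
      ((((1 - hubbardCutoffWeightCT L M β μ K (klScale klE0 (n - 1) + t * (klScale klE0 n - klScale klE0 (n - 1))) (z.2, z.1)) *
        (1 - hubbardCutoffWeightCT L M β μ K (klScale klE0 (n - 1) + t * (klScale klE0 n - klScale klE0 (n - 1)))
          (z.2.rev, Q - z.1)) : ℝ) : ℂ)))
    (hb'def : b' = fun t z => -((((β * (L : ℝ) ^ 2 : ℝ) : ℂ))⁻¹ * propCT L M β μ K (z.2, z.1) * propCT L M β μ K (z.2.rev, Q - z.1)) *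
      ((((klScale klE0 n - klScale klE0 (n - 1)) *
          (-deriv (fun Λ' : ℝ => hubbardCutoffWeightCT L M β μ K Λ' (z.2, z.1))
              (klScale klE0 (n - 1) + t * (klScale klE0 n - klScale klE0 (n - 1))) *
            (1 - hubbardCutoffWeightCT L M β μ K (klScale klE0 (n - 1) + t * (klScale klE0 n - klScale klE0 (n - 1)))
              (z.2.rev, Q - z.1)) -
          (1 - hubbardCutoffWeightCT L M β μ K (klScale klE0 (n - 1) + t * (klScale klE0 n - klScale klE0 (n - 1))) (z.2, z.1)) *
            deriv (fun Λ' : ℝ => hubbardCutoffWeightCT L M β μ K Λ' (z.2.rev, Q - z.1))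
              (klScale klE0 (n - 1) + t * (klScale klE0 n - klScale klE0 (n - 1)))) : ℝ) : ℂ)))
    (hXs : Xs = fun t => Γ' t + Γ t * diagonal (b' t) * Γ t)
    (w₁ : TorusSite 2 L → ℝ) (hw₁ : ∀ s, ∑ c : MatsubaraIdx M, (b 1 (s, c) - b 0 (s, c)) = (w₁ s : ℂ))
    {mW Zρ : ℝ} (hmW : 0 ≤ mW) (hΓm : ∀ t ∈ Icc (0 : ℝ) 1, ∀ x y, ‖Γ t x y‖ ≤ mW)
    (hZρ : ∑ z, ‖b 1 z - b 0 z‖ ≤ Zρ) (hsm : 3 / 2 * mW * Zρ ≤ 1 / 3)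
    (IX : TorusSite 2 L × MatsubaraIdx M → TorusSite 2 L × MatsubaraIdx M → ℝ)
    (hIX : ∀ x y, (∫ t in (0 : ℝ)..1, ‖Xs t x y‖) ≤ IX x y) :
    ∃ N : Matrix (TorusSite 2 L) (TorusSite 2 L) ℂ,
      (1 + diagonal (fun p => (w₁ p : ℂ)) * klWickPairArray L M β U μ K (n - 1) Q) * N = 1 ∧
      N * (1 + diagonal (fun p => (w₁ p : ℂ)) * klWickPairArray L M β U μ K (n - 1) Q) = 1 ∧
      ∀ k ∈ klBall L μ K, ∀ k' ∈ klBall L μ K,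
        ‖klWickPairArray L M β U μ K n Q k k' - (klWickPairArray L M β U μ K (n - 1) Q * N) k k'‖ ≤
          (IX (k, omega0 M) (k', omega0 M) +
              3 / 2 * (3 / 2 * mW) * ∑ c, IX (k, omega0 M) c * ‖b 1 c - b 0 c‖ +
              3 / 2 * mW * ∑ a, ‖b 1 a - b 0 a‖ * IX a (k', omega0 M) +
              9 / 4 * mW * (3 / 2 * mW) * ∑ a, ∑ c, ‖b 1 a - b 0 a‖ * IX a c * ‖b 1 c - b 0 c‖) +
            (3 / 2 * mW * ∑ c, ‖klWickPairKernel L M β U μ K (n - 1) Q (k, omega0 M) c -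
                klWickPairArray L M β U μ K (n - 1) Q k c.1‖ * ‖b 1 c - b 0 c‖ +
              3 / 2 * mW * ∑ a, ‖b 1 a - b 0 a‖ * ‖klWickPairKernel L M β U μ K (n - 1) Q a (k', omega0 M) -
                klWickPairArray L M β U μ K (n - 1) Q a.1 k'‖ +
              9 / 4 * mW * mW * ∑ a, ∑ c, ‖b 1 a - b 0 a‖ * ‖klWickPairKernel L M β U μ K (n - 1) Q a c -
                klWickPairArray L M β U μ K (n - 1) Q a.1 c.1‖ * ‖b 1 c - b 0 c‖) := by
  obtain ⟨hpos, hle⟩ := klws_klScale_pos_antitone n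
  -- (1) the rungs are differentiable along the path, (2) with continuous derivative
  have hb : ∀ t ∈ Icc (0 : ℝ) 1, ∀ z, HasDerivAt (fun s => b s z) (b' t z) t := by
    intro t ht z
    subst hbdef hb'def
    have h := ((klws_hasDerivAt_softWeightPair_path L M β μ K hle hpos ht (z.2, z.1) (z.2.rev, Q - z.1)).ofReal_comp).const_mul
      (-((((β * (L : ℝ) ^ 2 : ℝ) : ℂ))⁻¹ * propCT L M β μ K (z.2, z.1) * propCT L M β μ K (z.2.rev, Q - z.1)))
    simpa only [Function.comp_def] using h
  have hb'c : ∀ z, ContinuousOn (fun t => b' t z) (Icc 0 1) := by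
    intro z
    subst hb'def
    have h := klws_continuousOn_softWeightPair_deriv_path L M β μ K hle hpos (z.2, z.1) (z.2.rev, Q - z.1)
    exact continuousOn_const.mul (Complex.continuous_ofReal.comp_continuousOn h)
  -- (3) the rate is bounded along the compact path
  obtain ⟨βr, hβr⟩ : ∃ βr : ℝ, ∀ t ∈ Icc (0 : ℝ) 1, ∑ a, ‖b' t a‖ ≤ βr := by
    have hcont : ContinuousOn (fun t => ∑ a, ‖b' t a‖) (Icc (0 : ℝ) 1) :=
      continuousOn_finsetSum _ fun a _ => (hb'c a).norm
    obtain ⟨βr, hβr⟩ := isCompact_Icc.bddAbove_image hcont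
    exact ⟨βr, fun t ht => hβr ⟨t, ht, rfl⟩⟩
  -- (4) the tails are bounded by the full increment (monotonicity of the soft pair weight)
  have hanti : ∀ z : TorusSite 2 L × MatsubaraIdx M, AntitoneOn
      (fun t : ℝ => (1 - hubbardCutoffWeightCT L M β μ K
          (klScale klE0 (n - 1) + t * (klScale klE0 n - klScale klE0 (n - 1))) (z.2, z.1)) *
        (1 - hubbardCutoffWeightCT L M β μ K
          (klScale klE0 (n - 1) + t * (klScale klE0 n - klScale klE0 (n - 1))) (z.2.rev, Q - z.1))) (Icc 0 1) := fun z =>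
    klws_softWeightPair_antitoneOn_path L M β μ K hle hpos (z.2, z.1) (z.2.rev, Q - z.1)
  have hbform : ∀ t z, b t z = (fun z : TorusSite 2 L × MatsubaraIdx M =>
      -((((β * (L : ℝ) ^ 2 : ℝ) : ℂ))⁻¹ * propCT L M β μ K (z.2, z.1) * propCT L M β μ K (z.2.rev, Q - z.1))) z *
      (((fun (t : ℝ) (z : TorusSite 2 L × MatsubaraIdx M) =>
        (1 - hubbardCutoffWeightCT L M β μ K
            (klScale klE0 (n - 1) + t * (klScale klE0 n - klScale klE0 (n - 1))) (z.2, z.1)) *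
          (1 - hubbardCutoffWeightCT L M β μ K
            (klScale klE0 (n - 1) + t * (klScale klE0 n - klScale klE0 (n - 1))) (z.2.rev, Q - z.1))) t z : ℝ) : ℂ) := by
    intro t z; subst hbdef; rfl
  have hρ : ∀ t ∈ Icc (0 : ℝ) 1, ∀ a, ‖b 1 a - b t a‖ ≤ (fun z => ‖b 1 z - b 0 z‖) a := by
    intro t ht a
    have h1 := klws_rung_tail_le_of_antitone _ _ b hbform hanti ht a
    have h2 := klws_rung_composite_norm_eq _ _ b hbform hanti a
    dsimp only; rw [h2]; exact h1
  -- (5) the base array `X` is bounded by the a priori bound at `t = 0`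
  have h0 : ∀ a c : TorusSite 2 L × MatsubaraIdx M, Γ 0 a c = klWickPairKernel L M β U μ K (n - 1) Q a c := fun a c => by
    subst hΓdef
    simp only [Matrix.of_apply, zero_mul, add_zero]
    exact klws_pairKernelR_klScale L M β U μ K (n - 1) Q a c
  have hC : ∀ s t, ‖klWickPairArray L M β U μ K (n - 1) Q s t‖ ≤ mW := by
    intro s t
    by_cases hst : s ∈ klBall L μ K ∧ t ∈ klBall L μ K
    · rw [klws_wickPairArray_eq_kernel_on L M β U μ K (n - 1) Q hst.1 hst.2, ← h0]
      exact hΓm 0 ⟨le_rfl, zero_le_one⟩ _ _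
    · rw [klws_wickPairArray_eq_zero_off L M β U μ K (n - 1) Q s t hst, norm_zero]; exact hmW
  -- (6) smallness
  have hρ0 : ∀ a, 0 ≤ (fun z => ‖b 1 z - b 0 z‖) a := fun a => norm_nonneg _
  have hsm' : 3 / 2 * mW * ∑ a, (fun z => ‖b 1 z - b 0 z‖) a ≤ 1 / 3 :=
    (mul_le_mul_of_nonneg_left hZρ (by positivity)).trans hsm
  have hsm₀ : mW * ∑ a, (fun z => ‖b 1 z - b 0 z‖) a ≤ 1 / 3 := by
    have h1 : mW * ∑ a, (fun z => ‖b 1 z - b 0 z‖) a ≤ 3 / 2 * mW * ∑ a, (fun z => ‖b 1 z - b 0 z‖) a := by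
      have := sum_nonneg fun a (_ : a ∈ Finset.univ) => hρ0 a
      nlinarith
    exact h1.trans hsm'
  -- (7) the Duhamel step on the grid slice
  have hX : ∀ t ∈ Icc (0 : ℝ) 1, Xs t = Γ' t + Γ t * diagonal (b' t) * Γ t := fun t _ => by rw [hXs]
  obtain ⟨N, hN1, hN2, -, hstep⟩ := klws_wickStep_of_scaleFlow_grid L M β U μ K n hZ Q Γ Γ' Xs hΓdef hΓ'def
    (klWickPairArray L M β U μ K (n - 1) Q) b b' (fun z => ‖b 1 z - b 0 z‖) hmW hmW hC hb hb'c hX hΓm hβr hρ hsm' hsm₀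
  -- (8) the aggregated weight is the real `w₁`
  have hdiag : (fun s => ∑ c : MatsubaraIdx M, (b 1 - b 0) (s, c)) = fun p => (w₁ p : ℂ) := by
    funext s; simp only [Pi.sub_apply]; exact hw₁ s
  rw [hdiag] at hN1 hN2
  refine ⟨N, hN1, hN2, fun k hk k' hk' => ?_⟩
  have h := hstep (k, omega0 M) (k', omega0 M)
  simp only [Pi.sub_apply] at h
  rw [← klws_wickPairArray_eq_kernel_on L M β U μ K n Q hk hk',
    klws_wickPairArray_eq_kernel_on L M β U μ K (n - 1) Q hk hk', sub_self, norm_zero, zero_add] at h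
  refine h.trans ?_
  -- monotonicity in the source majorant
  have hIX0 : ∀ x y, 0 ≤ IX x y := fun x y =>
    (intervalIntegral.integral_nonneg zero_le_one fun t _ => norm_nonneg _).trans (hIX x y)
  have e1 := hIX (k, omega0 M) (k', omega0 M)
  have e2 : 3 / 2 * (3 / 2 * mW) * ∑ c, (∫ t in (0 : ℝ)..1, ‖Xs t (k, omega0 M) c‖) * ‖b 1 c - b 0 c‖ ≤
      3 / 2 * (3 / 2 * mW) * ∑ c, IX (k, omega0 M) c * ‖b 1 c - b 0 c‖ :=
    mul_le_mul_of_nonneg_left (sum_le_sum fun c _ => mul_le_mul_of_nonneg_right (hIX _ _) (norm_nonneg _)) (by positivity)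
  have e3 : 3 / 2 * mW * ∑ a, ‖b 1 a - b 0 a‖ * (∫ t in (0 : ℝ)..1, ‖Xs t a (k', omega0 M)‖) ≤
      3 / 2 * mW * ∑ a, ‖b 1 a - b 0 a‖ * IX a (k', omega0 M) :=
    mul_le_mul_of_nonneg_left (sum_le_sum fun a _ => mul_le_mul_of_nonneg_left (hIX _ _) (norm_nonneg _)) (by positivity)
  have e4 : 9 / 4 * mW * (3 / 2 * mW) * ∑ a, ∑ c, ‖b 1 a - b 0 a‖ * (∫ t in (0 : ℝ)..1, ‖Xs t a c‖) * ‖b 1 c - b 0 c‖ ≤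
      9 / 4 * mW * (3 / 2 * mW) * ∑ a, ∑ c, ‖b 1 a - b 0 a‖ * IX a c * ‖b 1 c - b 0 c‖ :=
    mul_le_mul_of_nonneg_left (sum_le_sum fun a _ => sum_le_sum fun c _ =>
      mul_le_mul_of_nonneg_right (mul_le_mul_of_nonneg_left (hIX _ _) (norm_nonneg _)) (norm_nonneg _)) (by positivity)
  linarith [e1, e2, e3, e4]

/-! ## §2 The end-to-end composition: (E2-v10) at `1 ≤ n` from the scale flow, the straddles and the budget -/

/-- **(E2-v10) `PairLadderStepAtV10 … n` (`1 ≤ n`) on the CONTINUOUS organisation, end to end.**  Global inputs: the plain-array bound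
`|𝒞̂_{n−1}| ≤ m`; `Z^K ≠ 0` on `[Λ_n, Λ_{n−1}]`; the real-cutoff pair kernel `Γ`, its derivative `Γ̇`, the explicit soft-pair rungs `b, ḃ` and the
non-ladder source `X := Γ̇ + Γ·diag ḃ·Γ`, as functions of the total momentum (given by equations — pass `rfl` five times; read `X` through
`klws_flow_source_eq`).  Per pair class `Qm` (the taker's list): right inverses `M′` of `1 − diag b′·𝒞̂_{n−1}` and `M₀` of `1 − diag b·𝒞̂_n` with
real straddle weights `b′, b` and the FORWARD straddle errors `‖𝒞̂^W_{n−1} − 𝒞̂_{n−1}M′‖ ≤ R′ ≤ r′`, `‖𝒞̂^W_n − 𝒞̂_n M₀‖ ≤ E_R ≤ e_R` on `klBall²`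
(`𝒞̂^W_j = klWickPairArray … j Qm`); the real aggregated step weight `w₁` (`Σ_ν (b 1 − b 0)(k,ν) = w₁ k`); an a priori bound `m_W ≥ 0` of `Γ` along
the slice; the step mass `Σ‖b 1 − b 0‖ ≤ Z_ρ` with `(3/2)m_W Z_ρ ≤ 1/3`; a source majorant `IX ≥ ∫₀¹‖X_t‖`; a Wick-step majorant `E_a ≥ 0` with
`FT_ρ(IX) + [localisation four-term] ≤ E_a` at the external entries (the conclusion of `klws_wickArrayStep_of_scaleFlow_grid`); intermediate
majorants `E₁ ≥ E_a + FT_{|w₁|}(R′)`, `E₁ ≤ e₁`, `E₂ ≥ E_R + E₁`; smallness `m·Σ|b′| ≤ 1/3`, `((3/2)m + r′)·Σ|w₁| ≤ 1/3`,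
`((9/4)m + e₁ + e_R)·Σ|b| ≤ 1/3`; the two mass clauses of the composite weight `w₁ + b − b′`; and the closed-form V10 budget
`FT_{|b|}(E₂) ≤ drivePBar + eremBar + thermalBar + legDressBarQ2·countT + (Klam U)²(phGain n|k−k′|_𝕋 + phGain n|k+k′−Qm|_𝕋)`.
THEN `PairLadderStepAtV10 L M G P Q β U μ K n`. -/
theorem pairLadderStepAtV10_of_scaleFlow {G : GeoConsts} {P : SplitConsts} {Q : EngConsts} {n : ℕ} {m : ℝ} (hn : 1 ≤ n) (hm : 0 ≤ m)
    (hC₀ : ∀ Qm s t, ‖klPairArray L M β U μ K (n - 1) Qm s t‖ ≤ m)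
    (hZ : ∀ Λ ∈ Icc (klScale klE0 n) (klScale klE0 (n - 1)), hubbardEffPartitionFnCT L M β U μ 0 K Λ ≠ 0)
    (Γ Γ' Xs : TorusSite 2 L → ℝ → Matrix (TorusSite 2 L × MatsubaraIdx M) (TorusSite 2 L × MatsubaraIdx M) ℂ)
    (b b' : TorusSite 2 L → ℝ → TorusSite 2 L × MatsubaraIdx M → ℂ)
    (hΓdef : Γ = fun Qm t => Matrix.of fun x y => vertexFn L M β
      (gaussConv ℂ (hubbardCovBelowCT L M β μ 0 K (klScale klE0 (n - 1) + t * (klScale klE0 n - klScale klE0 (n - 1))))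
        (hubbardEffectiveActionCT L M β U μ 0 K (klScale klE0 (n - 1) + t * (klScale klE0 n - klScale klE0 (n - 1))))) 4
      ![(((y.2, y.1), 0), 0), (((y.2.rev, Qm - y.1), 1), 0), (((x.2.rev, Qm - x.1), 1), 1), (((x.2, x.1), 0), 1)])
    (hΓ'def : Γ' = fun Qm t => Matrix.of fun x y => (klScale klE0 n - klScale klE0 (n - 1)) • -((2 : ℂ)⁻¹ * vertexFn L M β
      (gaussConv ℂ (hubbardCovBelowCT L M β μ 0 K (klScale klE0 (n - 1) + t * (klScale klE0 n - klScale klE0 (n - 1))))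
        (grassmannDerivPairing ℂ
          (Matrix.of fun X Y : HubbardFieldIdx L M =>
            deriv (fun Λ'' : ℝ => hubbardCovAboveCT L M β μ 0 K Λ'' X Y)
              (klScale klE0 (n - 1) + t * (klScale klE0 n - klScale klE0 (n - 1))))
          (hubbardEffectiveActionCT L M β U μ 0 K (klScale klE0 (n - 1) + t * (klScale klE0 n - klScale klE0 (n - 1))))
          (hubbardEffectiveActionCT L M β U μ 0 K (klScale klE0 (n - 1) + t * (klScale klE0 n - klScale klE0 (n - 1)))))) 4
      ![(((y.2, y.1), 0), 0), (((y.2.rev, Qm - y.1), 1), 0), (((x.2.rev, Qm - x.1), 1), 1), (((x.2, x.1), 0), 1)]))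
    (hbdef : b = fun Qm t z => -((((β * (L : ℝ) ^ 2 : ℝ) : ℂ))⁻¹ * propCT L M β μ K (z.2, z.1) * propCT L M β μ K (z.2.rev, Qm - z.1)) *
      ((((1 - hubbardCutoffWeightCT L M β μ K (klScale klE0 (n - 1) + t * (klScale klE0 n - klScale klE0 (n - 1))) (z.2, z.1)) *
        (1 - hubbardCutoffWeightCT L M β μ K (klScale klE0 (n - 1) + t * (klScale klE0 n - klScale klE0 (n - 1)))
          (z.2.rev, Qm - z.1)) : ℝ) : ℂ)))
    (hb'def : b' = fun Qm t z => -((((β * (L : ℝ) ^ 2 : ℝ) : ℂ))⁻¹ * propCT L M β μ K (z.2, z.1) * propCT L M β μ K (z.2.rev, Qm - z.1)) *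
      ((((klScale klE0 n - klScale klE0 (n - 1)) *
          (-deriv (fun Λ' : ℝ => hubbardCutoffWeightCT L M β μ K Λ' (z.2, z.1))
              (klScale klE0 (n - 1) + t * (klScale klE0 n - klScale klE0 (n - 1))) *
            (1 - hubbardCutoffWeightCT L M β μ K (klScale klE0 (n - 1) + t * (klScale klE0 n - klScale klE0 (n - 1)))
              (z.2.rev, Qm - z.1)) -
          (1 - hubbardCutoffWeightCT L M β μ K (klScale klE0 (n - 1) + t * (klScale klE0 n - klScale klE0 (n - 1))) (z.2, z.1)) *
            deriv (fun Λ' : ℝ => hubbardCutoffWeightCT L M β μ K Λ' (z.2.rev, Qm - z.1))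
              (klScale klE0 (n - 1) + t * (klScale klE0 n - klScale klE0 (n - 1)))) : ℝ) : ℂ)))
    (hXs : Xs = fun Qm t => Γ' Qm t + Γ Qm t * diagonal (b' Qm t) * Γ Qm t)
    (htower : ∀ Qm : TorusSite 2 L, IsPairClassAt L Qm n →
      ∃ (M' M₀ : Matrix (TorusSite 2 L) (TorusSite 2 L) ℂ) (bp w₁ bs : TorusSite 2 L → ℝ)
        (R' Ea ER E₁ E₂ : TorusSite 2 L → TorusSite 2 L → ℝ)
        (IX : TorusSite 2 L × MatsubaraIdx M → TorusSite 2 L × MatsubaraIdx M → ℝ) (r' eR e₁ mW Zρ : ℝ),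
        0 ≤ r' ∧ 0 ≤ eR ∧ 0 ≤ e₁ ∧ 0 ≤ mW ∧
        (∀ x y, 0 ≤ R' x y) ∧ (∀ x y, 0 ≤ Ea x y) ∧ (∀ x y, 0 ≤ ER x y) ∧
        -- the Wick step from the scale flow
        (∀ s, ∑ c : MatsubaraIdx M, (b Qm 1 (s, c) - b Qm 0 (s, c)) = (w₁ s : ℂ)) ∧
        (∀ t ∈ Icc (0 : ℝ) 1, ∀ x y, ‖Γ Qm t x y‖ ≤ mW) ∧
        (∑ z, ‖b Qm 1 z - b Qm 0 z‖ ≤ Zρ) ∧ 3 / 2 * mW * Zρ ≤ 1 / 3 ∧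
        (∀ x y, (∫ t in (0 : ℝ)..1, ‖Xs Qm t x y‖) ≤ IX x y) ∧
        (∀ k ∈ klBall L μ K, ∀ k' ∈ klBall L μ K,
          (IX (k, omega0 M) (k', omega0 M) +
              3 / 2 * (3 / 2 * mW) * ∑ c, IX (k, omega0 M) c * ‖b Qm 1 c - b Qm 0 c‖ +
              3 / 2 * mW * ∑ a, ‖b Qm 1 a - b Qm 0 a‖ * IX a (k', omega0 M) +
              9 / 4 * mW * (3 / 2 * mW) * ∑ a, ∑ c, ‖b Qm 1 a - b Qm 0 a‖ * IX a c * ‖b Qm 1 c - b Qm 0 c‖) +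
            (3 / 2 * mW * ∑ c, ‖klWickPairKernel L M β U μ K (n - 1) Qm (k, omega0 M) c -
                klWickPairArray L M β U μ K (n - 1) Qm k c.1‖ * ‖b Qm 1 c - b Qm 0 c‖ +
              3 / 2 * mW * ∑ a, ‖b Qm 1 a - b Qm 0 a‖ * ‖klWickPairKernel L M β U μ K (n - 1) Qm a (k', omega0 M) -
                klWickPairArray L M β U μ K (n - 1) Qm a.1 k'‖ +
              9 / 4 * mW * mW * ∑ a, ∑ c, ‖b Qm 1 a - b Qm 0 a‖ * ‖klWickPairKernel L M β U μ K (n - 1) Qm a c -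
                klWickPairArray L M β U μ K (n - 1) Qm a.1 c.1‖ * ‖b Qm 1 c - b Qm 0 c‖) ≤ Ea k k') ∧
        -- the forward straddle relations (S)_{n−1}, (S)_n
        (1 - diagonal (fun p => (bp p : ℂ)) * klPairArray L M β U μ K (n - 1) Qm) * M' = 1 ∧
        (∀ k ∈ klBall L μ K, ∀ k' ∈ klBall L μ K,
          ‖klWickPairArray L M β U μ K (n - 1) Qm k k' - (klPairArray L M β U μ K (n - 1) Qm * M') k k'‖ ≤ R' k k') ∧
        (∀ x y, R' x y ≤ r') ∧
        (1 - diagonal (fun p => (bs p : ℂ)) * klPairArray L M β U μ K n Qm) * M₀ = 1 ∧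
        (∀ k ∈ klBall L μ K, ∀ k' ∈ klBall L μ K,
          ‖klWickPairArray L M β U μ K n Qm k k' - (klPairArray L M β U μ K n Qm * M₀) k k'‖ ≤ ER k k') ∧
        (∀ x y, ER x y ≤ eR) ∧
        -- the intermediate majorants and the smallness conditions
        (∀ x y, Ea x y + (R' x y + 3 / 2 * (3 / 2 * m) * ∑ t, R' x t * |w₁ t| + 3 / 2 * (3 / 2 * m + r') * ∑ a, |w₁ a| * R' a y +
            9 / 4 * (3 / 2 * m + r') * (3 / 2 * m) * ∑ a, ∑ t, |w₁ a| * R' a t * |w₁ t|) ≤ E₁ x y) ∧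
        (∀ x y, E₁ x y ≤ e₁) ∧ (∀ x y, ER x y + E₁ x y ≤ E₂ x y) ∧
        m * ∑ a, |bp a| ≤ 1 / 3 ∧ (3 / 2 * m + r') * ∑ a, |w₁ a| ≤ 1 / 3 ∧ (9 / 4 * m + e₁ + eR) * ∑ a, |bs a| ≤ 1 / 3 ∧
        -- the composite weight's masses and the V10 budget
        (∑ p, |w₁ p + bs p - bp p| ≤ G.bhi) ∧
        (∑ p, (|w₁ p + bs p - bp p| - (w₁ p + bs p - bp p)) ≤ 2 * klEdge G n (klTorusNorm L Qm)) ∧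
        (∀ k ∈ klBall L μ K, ∀ k' ∈ klBall L μ K,
          E₂ k k' + 3 / 2 * (9 / 4 * m) * ∑ t, E₂ k t * |bs t| + 3 / 2 * (9 / 4 * m + e₁ + eR) * ∑ a, |bs a| * E₂ a k' +
              9 / 4 * (9 / 4 * m + e₁ + eR) * (9 / 4 * m) * ∑ a, ∑ t, |bs a| * E₂ a t * |bs t| ≤
            drivePBar G P U (n - 1) + eremBar G P Q U β L (n - 1) + thermalBar G P U β n +
              legDressBarQ2 G P Q U n (legSliceCountT L β μ K n ![k', Qm - k', Qm - k, k]) +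
              (P.Klam * U) ^ 2 * (G.phGain n (klTorusNorm L (k - k')) + G.phGain n (klTorusNorm L (k + k' - Qm))))) :
    PairLadderStepAtV10 L M G P Q β U μ K n := by
  refine pairLadderStepAtV10_of_wickTower_fwd L M hn hm hC₀ fun Qm hQm => ?_
  obtain ⟨M', M₀, bp, w₁, bs, R', Ea, ER, E₁, E₂, IX, r', eR, e₁, mW, Zρ, hr', heR, he₁, hmW, hR'0, hEa0, hER0, hw₁, hΓm, hZρ, hsm,
    hIX, hEa, hM', hR', hR'e, hM₀, hER, hERe, hE₁, hE₁e, hE₂, hsm₀, hsm₁, hsm₂, hmass, hneg, hbud⟩ := htower Qm hQm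
  obtain ⟨N, hN1, -, hstep⟩ := klws_wickArrayStep_of_scaleFlow_grid L M β U μ K n hZ Qm (Γ Qm) (Γ' Qm) (Xs Qm) (b Qm) (b' Qm)
    (by subst hΓdef; rfl) (by subst hΓ'def; rfl) (by subst hbdef; rfl) (by subst hb'def; rfl) (by subst hXs; rfl) w₁ hw₁ hmW hΓm hZρ hsm
    IX hIX
  exact ⟨klWickPairArray L M β U μ K (n - 1) Qm, klWickPairArray L M β U μ K n Qm, M', N, M₀, bp, w₁, bs, R', Ea, ER, E₁, E₂, r', eR,
    e₁, hr', heR, he₁, klws_wickPairArray_eq_zero_off L M β U μ K (n - 1) Qm, klws_wickPairArray_eq_zero_off L M β U μ K n Qm, hR'0,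
    hEa0, hER0, hM', hR', hR'e, hN1, fun k hk k' hk' => (hstep k hk k' hk').trans (hEa k hk k' hk'), hM₀, hER, hERe, hE₁, hE₁e, hE₂,
    hsm₀, hsm₁, hsm₂, hmass, hneg, hbud⟩

end Model

end Summit.HubbardSuperconductivity.HubbardSuperconductivity.Theorems.KLRegimeWick

end
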